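import Literature.Algebra.Polynomial.UmbralInversePairs
import Mathlib.RingTheory.PowerSeries.Catalan
import Mathlib.RingTheory.PowerSeries.WellKnown
import Mathlib.Tactic
import HarnessLib

/-!
# The delta operator `D (I − D)`: its basic polynomials and its inverse series (Rota–Kahaner–Odlyzko §13, "The Heaviside Calculus")

G.-C. Rota, D. Kahaner, A. Odlyzko, *Finite operator calculus* (1973), §13 "The Heaviside Calculus",
pp. 740–741, on the expansion `sin πx = Σ_n a_n (x (1 − x))ⁿ/n!` (Schur, Carlitz 1966):

> Now, it is obvious from (*) that the delta operator in question is `Q = D (I − D)`, whose basic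
> polynomials are `p_n (x)`, computed by `p_n (x) = x (I − D)^{−n} x^{n−1}`, that is,
> `(I − D)^{−n} = (I + D + D² + D³ + ⋯)ⁿ = I + nD + C(n+1, 2) D² + ⋯`,
> `p_n (x) = Σ_{i≥0} C(n + i − 1, i) (n − 1)_i x^{n−i}`; thus (Theorem 3) [`a_n = [p_n (D) sin πx]_{x=0}`] …

Typed here (all proved; the analytic part about `sin πx` is not): the operator `Q = D (I − D) = (t − t²)(D)`
(`derivative ∘ₗ diffOp (1 − X)`), the printed basic polynomials via the transfer formula (Theorem 4 (3),
tree `IsDeltaOperator.basicSequence_eq_X_mul_diffOp`) and the negative-binomial coefficients of `(1 − t)^{−n}`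
(Mathlib `PowerSeries.mk_add_choose_mul_one_sub_pow_eq_one`):
`p_n (x) = Σ_{i<n} C(n − 1 + i, i) (n − 1)_i x^{n−i}` (`basicSequence_D_sub_D_sq`), and — §4 Theorem 5
Corollary 2 for this `Q` — the inverse power series of `q (t) = t − t²` is `t C(t)` with `C` the Catalan series
(Mathlib `PowerSeries.catalanSeries`, `C = 1 + t C²`): `indicator_derivative_D_sub_D_sq` (the `Q`-indicator of `D`
is `t C(t)`), `X_sub_X_sq_subst_X_mul_catalan` (`(tC)(1 − tC) = t`), and the linear coefficients
`[x] p_{m+1} = (m+1)! · Catalan_m` (`coeff_one_basicSequence_D_sub_D_sq`, with the printed value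
`C(2m, m) · m!`, `coeff_one_basicSequence_D_sub_D_sq'`).

## References
* [RotaKahanerOdlyzko1973] G.-C. Rota, D. Kahaner, A. Odlyzko, *On the foundations of
  combinatorial theory VIII. Finite operator calculus*, J. Math. Anal. Appl. 42 (1973) 684–760,
  §13 "The Heaviside Calculus", pp. 740–741 (with §4 Theorem 4 (3), p. 695, and Theorem 5
  Corollary 2, p. 697).
-/

noncomputable section

open Polynomial Finset

namespace Literature.Algebra.Polynomial

variable (K : Type*) [Field K] [CharZero K]

/-! ## `Q = D (I − D)` and its basic polynomials -/

/-- `Q = D (I − D)` is the composition operator `(t − t²)(D)`.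
[cite: RotaKahanerOdlyzko1973, §13 ("the delta operator in question is `Q = D (I − D)`"), p. 741] -/
theorem derivative_comp_diffOp_one_sub_X :
    (derivative ∘ₗ diffOp ((1 : PowerSeries K) - PowerSeries.X) : K[X] →ₗ[K] K[X]) =
      diffOp (PowerSeries.X - PowerSeries.X ^ 2) := by
  rw [derivative_comp_diffOp_eq, mul_sub, mul_one, sq]

/-- `Q = D (I − D)` is a delta operator (`I − D` is invertible).
[cite: RotaKahanerOdlyzko1973, §13, p. 741] -/
theorem isDeltaOperator_D_sub_D_sq :
    IsDeltaOperator (derivative ∘ₗ diffOp ((1 : PowerSeries K) - PowerSeries.X) : K[X] →ₗ[K] K[X]) :=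
  isDeltaOperator_derivative_comp_diffOp (constantCoeff_one_sub_X_ne_zero K)

omit [CharZero K] in
/-- **`(I − D)^{−n} = (I + D + D² + ⋯)ⁿ = I + nD + C(n+1, 2) D² + ⋯`**: `[tⁱ] (1 − t)^{−(m+1)} = C(m + i, i)`.
[cite: RotaKahanerOdlyzko1973, §13, p. 741] -/
theorem coeff_one_sub_X_inv_pow (m i : ℕ) :
    PowerSeries.coeff i ((((1 : PowerSeries K) - PowerSeries.X)⁻¹) ^ (m + 1)) = ((m + i).choose i : K) := by
  have hinv : (((1 : PowerSeries K) - PowerSeries.X)⁻¹) ^ (m + 1) =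
      PowerSeries.mk fun n => ((m + n).choose m : K) := by
    rw [← powerSeries_inv_pow (constantCoeff_one_sub_X_ne_zero K), eq_comm,
      PowerSeries.eq_inv_iff_mul_eq_one (constantCoeff_one_sub_X_pow_ne_zero K (m + 1))]
    exact_mod_cast PowerSeries.mk_add_choose_mul_one_sub_pow_eq_one (S := K) (d := m)
  rw [hinv, PowerSeries.coeff_mk, Nat.choose_symm_add]

/-- **The basic polynomials of `D (I − D)`** ("computed by `p_n (x) = x (I − D)^{−n} x^{n−1}`"):
`p_{m+1} (x) = Σ_{i=0}^{m} C(m + i, i) (m)_i x^{m+1−i}`, i.e. `p_n = Σ_i C(n+i−1, i) (n−1)_i x^{n−i}`.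
[cite: RotaKahanerOdlyzko1973, §13, p. 741] [cite: RotaKahanerOdlyzko1973, §4 Theorem 4 (3), p. 695] -/
theorem basicSequence_D_sub_D_sq (m : ℕ) :
    (isDeltaOperator_D_sub_D_sq K).basicSequence (m + 1) =
      ∑ i ∈ range (m + 1), (((m + i).choose i : K) * (m.descFactorial i : K)) • (X : K[X]) ^ (m + 1 - i) := by
  rw [(isDeltaOperator_D_sub_D_sq K).basicSequence_eq_X_mul_diffOp (constantCoeff_one_sub_X_ne_zero K) rfl
      (Nat.add_one_ne_zero m), Nat.add_sub_cancel, diffOp_apply_X_pow, mul_sum]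
  refine sum_congr rfl fun i hi => ?_
  have him : i ≤ m := Nat.lt_succ_iff.1 (mem_range.1 hi)
  rw [coeff_one_sub_X_inv_pow, mul_smul_comm, ← pow_succ', show m - i + 1 = m + 1 - i by omega]

/-! ## The inverse series of `t − t²` is `t C(t)`, `C` the Catalan series -/

omit [CharZero K] in
/-- The Catalan functional equation over `K`: `C = 1 + t C²`. [cite: RotaKahanerOdlyzko1973, §13, p. 741] -/
theorem catalanSeries_map_eq :
    PowerSeries.map (Nat.castRingHom K) PowerSeries.catalanSeries =
      1 + PowerSeries.X * PowerSeries.map (Nat.castRingHom K) PowerSeries.catalanSeries ^ 2 := by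
  have h := congrArg (PowerSeries.map (Nat.castRingHom K)) PowerSeries.catalanSeries_sq_mul_X_add_one
  rw [map_add, map_mul, map_pow, PowerSeries.map_X, map_one] at h
  linear_combination -h

omit [CharZero K] in
/-- **`(t − t²) ∘ (t C(t)) = t`**: `t C(t)` is a right inverse of `q (t) = t − t²` under composition.
[cite: RotaKahanerOdlyzko1973, §13, p. 741] [cite: RotaKahanerOdlyzko1973, §4 Theorem 5 Corollary 2, p. 697] -/
theorem X_sub_X_sq_subst_X_mul_catalan :
    ((PowerSeries.X - PowerSeries.X ^ 2 : PowerSeries K).subst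
        (PowerSeries.X * PowerSeries.map (Nat.castRingHom K) PowerSeries.catalanSeries) : PowerSeries K) =
      PowerSeries.X := by
  have h0 : PowerSeries.constantCoeff
      (PowerSeries.X * PowerSeries.map (Nat.castRingHom K) PowerSeries.catalanSeries) = 0 := by
    rw [map_mul, PowerSeries.constantCoeff_X, zero_mul]
  have hs := PowerSeries.HasSubst.of_constantCoeff_zero' h0
  rw [PowerSeries.subst_sub hs, PowerSeries.subst_pow hs, PowerSeries.subst_X hs]
  have hC := catalanSeries_map_eq K
  linear_combination PowerSeries.X * hC

/-- **The `Q`-indicator of `D` for `Q = D (I − D)` is `t C(t)`** (the inverse power series `q⁻¹` of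
`q (t) = t − t²`, §4 Theorem 5 Corollary 2: `q⁻¹ (t) = Σ_n [x] p_n tⁿ/n!`).
[cite: RotaKahanerOdlyzko1973, §4 Theorem 5 Corollary 2, p. 697] [cite: RotaKahanerOdlyzko1973, §13, p. 741] -/
theorem indicator_derivative_D_sub_D_sq :
    (isDeltaOperator_D_sub_D_sq K).indicator derivative =
      PowerSeries.X * PowerSeries.map (Nat.castRingHom K) PowerSeries.catalanSeries :=
  ((isDeltaOperator_D_sub_D_sq K).eq_indicator_derivative_of_subst_eq_X (derivative_comp_diffOp_one_sub_X K)
    (by rw [map_mul, PowerSeries.constantCoeff_X, zero_mul]) (X_sub_X_sq_subst_X_mul_catalan K)).symm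

/-- **The linear coefficients of the basic polynomials are factorial multiples of the Catalan numbers**:
`[x] p_{m+1} = (m+1)! · C_m` (Theorem 5 Corollary 2 read backwards from `q⁻¹ = t C(t)`).
[cite: RotaKahanerOdlyzko1973, §4 Theorem 5 Corollary 2, p. 697] [cite: RotaKahanerOdlyzko1973, §13, p. 741] -/
theorem coeff_one_basicSequence_D_sub_D_sq (m : ℕ) :
    ((isDeltaOperator_D_sub_D_sq K).basicSequence (m + 1)).coeff 1 = ((m + 1).factorial : K) * (catalan m : K) := by
  have h := (isDeltaOperator_D_sub_D_sq K).coeff_indicator_derivative (m + 1)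
  rw [indicator_derivative_D_sub_D_sq, PowerSeries.coeff_succ_X_mul, PowerSeries.coeff_map,
    PowerSeries.catalanSeries_coeff, eq_div_iff (Nat.cast_ne_zero.2 (Nat.factorial_ne_zero _))] at h
  rw [← h, eq_natCast, mul_comm]

/-- … in the printed form: `[x] p_{m+1} = C(2m, m) · m!` (the `i = m` term of `basicSequence_D_sub_D_sq`),
consistent with `(m+1) C_m = C(2m, m)`. [cite: RotaKahanerOdlyzko1973, §13, p. 741] -/
theorem coeff_one_basicSequence_D_sub_D_sq' (m : ℕ) :
    ((isDeltaOperator_D_sub_D_sq K).basicSequence (m + 1)).coeff 1 = ((2 * m).choose m : K) * (m.factorial : K) := by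
  rw [coeff_one_basicSequence_D_sub_D_sq, ← Nat.centralBinom_eq_two_mul_choose, ← succ_mul_catalan_eq_centralBinom,
    Nat.factorial_succ]
  push_cast
  ring

end Literature.Algebra.Polynomial
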